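import Mathlib
import Literature.Analysis.FluidPDE.KNSSTypeIIHolds
import Literature.Analysis.FluidPDE.NSSerrinRegularityProofs
import Summits.NavierStokesRegularity.OSWSelfSimilar.TypeIIInnerLimitCaseAStanding
import HarnessLib
/-!
# The inner object of an axisymmetric SINGULARITY is constant in space, if (AX-L) holds
# (zone Z1 TEMPLATE §T1.4-I from K8's standing hypotheses verbatim; kernel modulo (AX-L))

HONEST FRAMING (cell ns-blowup GROUP B «PROFILE SEARCH», zone Z1; D-0035/D-0074): part XXIII of the Z1 dictionary — the
assembled dichotomy of part XXII restated on K8's standing hypotheses AS THE CENSUS PRINTS THEM: `(u, p)` a MAXIMAL smooth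
solution with lifespan `T⋆` (`IsMaximalSmoothSolution`: classical on `[0, T⋆)`, no smooth extension past `T⋆`), Leray–Hopf
on `[0, T⋆)` from `u 0`, bounded on every closed sub-slab, axisymmetric slices, bounded initial swirl. The two template
inputs of part XXII are DISCHARGED from these: the energy bound on sub-slabs is the Leray–Hopf energy inequality
(`IsLerayHopfOn.eEnergy_le_datum`), and UNBOUNDEDNESS on `[0, T⋆)` is the contrapositive of the tree's DISCHARGED
continuation criterion `hasSmoothExtensionPast_of_bounded_holds` (RRS 2016 Thm 8.17 / Leray 1934: a bounded
Leray–Hopf classical solution extends smoothly past `T⋆`).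

* `energyBound_of_lerayHopf`, `unbounded_of_not_hasSmoothExtensionPast`;
* `innerLimit_const_of_singularity_under_axisymmetricLiouville` — IF (AX-L) holds, an axisymmetric maximal smooth
  Leray–Hopf solution with finite lifespan, bounded on closed sub-slabs, with bounded initial swirl, has a gauge N-a
  zoom converging along a subsequence, slice-wise locally uniformly, to a KNSS blow-up limit `W` with
  `W(s, ·) ≡ W(s, 0)` for all `s < 0`: the Z1 inner object (I-2) is of type (I-4)(α) — never a non-trivial profile.

**Nothing here asserts that such a singular solution exists, nor that (AX-L) holds; this is not an NS regularity or
blow-up claim.** «violates: n/a — dictionary»; bears_on LADDER-NS N5/Z1 → N1 linear core / N0⁻ ((I-2)/(I-3)/(I-4)).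
Author: ns-blowup-profile-eng-1 g7, 2026-08-27.
-/

open Real Filter Topology Set MeasureTheory Function
open scoped ENNReal
open Literature.Analysis.FluidPDE

namespace Summit.NavierStokesRegularity.OSWSelfSimilar
namespace TypeIIModulationDictionary

section OfSingularity

variable {T Mₛ : ℝ} {u : ℝ → EuclideanSpace ℝ (Fin 3) → EuclideanSpace ℝ (Fin 3)}
  {p : ℝ → EuclideanSpace ℝ (Fin 3) → ℝ}

/-- **Energy bound on closed sub-slabs from Leray–Hopf**: `∫ ‖u(t)‖² ≤ 2 E(u₀) < ∞` for `t ∈ [0, S]`, `S < T⋆` — the energy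
inequality from `s = 0` (`IsLerayHopfOn.eEnergy_le_datum`). [new here — bookkeeping] -/
theorem energyBound_of_lerayHopf (hLH : IsLerayHopfOn T 1 0 (u 0) u) :
    ∀ S < T, ∃ C : ℝ≥0∞, C < ⊤ ∧ ∀ t ∈ Icc 0 S, ∫⁻ x, ‖u t x‖ₑ ^ 2 ≤ C :=
  fun _ hS => ⟨_, ENNReal.ofReal_lt_top, fun _ ht =>
    hLH.eEnergy_le_datum zero_le_one ⟨ht.1, ht.2.trans hS.le⟩⟩

/-- **A singular time forces unboundedness**: if `(u, p)` is classical (`ν = 1`, unforced) on `[0, T⋆)`, Leray–Hopf from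
`u 0`, and does NOT extend smoothly past `T⋆`, then `u` is unbounded on `[0, T⋆) × ℝ³` — the contrapositive of the
tree's discharged continuation criterion `hasSmoothExtensionPast_of_bounded_holds`. [new here — bookkeeping] -/
theorem unbounded_of_not_hasSmoothExtensionPast (hT : 0 < T) (hu : IsClassicalNSSolutionOn (Ico 0 T) 1 0 u p)
    (hLH : IsLerayHopfOn T 1 0 (u 0) u) (hsing : ¬ HasSmoothExtensionPast 1 0 u T) :
    ∀ N : ℝ, ∃ t ∈ Ico 0 T, ∃ x : EuclideanSpace ℝ (Fin 3), N < ‖u t x‖ := by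
  by_contra h
  simp only [not_forall, not_exists, not_and, not_lt] at h
  obtain ⟨N, hN⟩ := h
  exact hsing (hasSmoothExtensionPast_of_bounded_holds one_pos hT hu hLH ⟨N, fun t ht x => hN t ht x⟩)

/-- **TEMPLATE §T1.4-I ON K8's STANDING HYPOTHESES: the inner object of an axisymmetric singularity is constant in
space, IF (AX-L) HOLDS.** Let `(u, p)` be a maximal smooth solution (`ν = 1`, unforced) with finite lifespan `T⋆ > 0`
(classical on `[0, T⋆)`, no smooth extension past `T⋆`), Leray–Hopf on `[0, T⋆)` from `u 0`, bounded on every closed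
sub-slab `[0, S] × ℝ³` (`S < T⋆`), with axisymmetric slices and bounded initial swirl `|x_h| |u_θ(0, x)| ≤ Mₛ`. IF the
axisymmetric Liouville conjecture (AX-L) holds, then there are gauge N-a zoom data `tₖ ∈ [T⋆/2, T⋆)`, `λₖ > 0`,
`λₖ → 0`, centres `cₖ` (`λₖ‖u‖ ≤ 1` on `[0, tₖ]`) and a subsequence along which the zoom
`y ↦ λₖ u(tₖ + λₖ² s, cₖ + λₖ y)` converges slice-wise locally uniformly to a KNSS blow-up limit `W` (`|W| ≤ 1 = sup|W|`,
smooth bounded ancient mild) with `W(s, y) = W(s, 0)` for all `s < 0`, `y`. Part XXII with its two inputs discharged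
by `energyBound_of_lerayHopf` and `unbounded_of_not_hasSmoothExtensionPast`. [new here — dictionary; conditional on
(AX-L)] -/
theorem innerLimit_const_of_singularity_under_axisymmetricLiouville
    (hAXL : Summit.NavierStokesRegularity.NavierStokesRegularity.AxisymmetricLiouvilleBoundedSwirl)
    (hT : 0 < T) (hmax : IsMaximalSmoothSolution 1 0 u p T) (hLH : IsLerayHopfOn T 1 0 (u 0) u)
    (hbdd : ∀ S < T, ∃ N : ℝ, 0 < N ∧ ∀ t ∈ Icc 0 S, ∀ x, ‖u t x‖ ≤ N)
    (haxi : ∀ t, IsAxisymmetric (u t)) (hMₛ : ∀ x, |swirl (u 0) x| ≤ Mₛ) :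
    ∃ (tn lamn : ℕ → ℝ) (cn : ℕ → EuclideanSpace ℝ (Fin 3)) (φ : ℕ → ℕ)
      (W : ℝ → EuclideanSpace ℝ (Fin 3) → EuclideanSpace ℝ (Fin 3)),
      (∀ k, T / 2 ≤ tn k ∧ tn k < T) ∧ (∀ k, 0 < lamn k) ∧ Tendsto lamn atTop (𝓝 0) ∧
      (∀ k, ∀ t ∈ Icc 0 (tn k), ∀ x, lamn k * ‖u t x‖ ≤ 1) ∧ StrictMono φ ∧ IsKNSSBlowupLimit W ∧
      (∀ s < 0, TendstoLocallyUniformly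
        (fun k => (lamn (φ k) • stPull (lamn (φ k) ^ 2) (lamn (φ k)) (tn (φ k)) (cn (φ k)) u) s) (W s) atTop) ∧
      ∀ s < 0, ∀ y : EuclideanSpace ℝ (Fin 3), W s y = W s 0 :=
  innerLimit_const_of_unbounded_under_axisymmetricLiouville hAXL hT hmax.1 haxi (energyBound_of_lerayHopf hLH) hbdd
    hMₛ (unbounded_of_not_hasSmoothExtensionPast hT hmax.1 hLH hmax.2)

end OfSingularity

end TypeIIModulationDictionary
end Summit.NavierStokesRegularity.OSWSelfSimilar
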